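import Mathlib.Analysis.Normed.Module.Ball.Pointwise
import Literature.Topology.FourManifolds.BallStretch
import Literature.Topology.FourManifolds.FramedTubularNbhd
import Literature.Topology.FourManifolds.WhitneyModelSheets

/-!
# Stub `stub_handlebodyChart` of line `mk_friends` for crux `DcrGap`: the base-chart step
(item stmt-SmoothPoincare4-16128, route route-SmoothPoincare4-DottedCircleRasmussen)

The stub says: in a closed simply connected smooth `4`-manifold `X`, every germ chart `i` of the
model dotted handlebody `D_k = MMSW.modelHandlebody k ⊂ ℝ⁴` (smooth, injective, immersive on an
open `U ⊇ D_k`) agrees on `D_k`, after precomposition with a per-handle sphere twist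
`τ^ε = MMSW.fibreRot (z ↦ Π_j u_j(z)^{ε_j})`, with a GLOBAL smooth embedding `e : ℝ⁴ ↪ X`.
Informal proof (Kirby calculus folklore: "`1`-handles attach uniquely up to isotopy and the
`ℤ/2` twist"): (1) extend `i` near a flat base ellipsoid `A ⊂ D_k°` to a global chart
`e₁ = i ∘ ψ` (`ψ` a self-embedding of `ℝ⁴` into `U` fixing `A`; no disc theorem is needed since
`e₁` is ours to choose); (2) the `k` core arcs of `D_k` under `i` and under `e₁` have the same end
germs in `e₁(A)`, are homotopic rel ends off `e₁(A)` (`π₁(X ∖ ball) = π₁(X) = 1`), hence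
ambient isotopic rel ends and rel `e₁(A)` (Whitney 1936 / Milnor 1965 Thm. 8.4 for the compact
`1`-manifold `⊔ⱼ [-1, 1]`, `4 = 2·1 + 2`, plus isotopy extension, Hirsch Ch. 8 §1 Thm. 1.3) —
the named fact `arcs_ambientIsotopic_rel_of_homotopicRel`; (3) the `1`-handles of `D_k`
along these arcs under the two charts are two tubes with common core and common feet, so they
agree after a further ambient isotopy rel the base and the other handles, up to the fibre twist
`m_j ∈ π₁(SO(3)) = ℤ/2` (uniqueness of tubular neighbourhoods, Hirsch Ch. 4 §5 Thm. 5.3, with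
isotopy extension) — the named fact `oneHandle_ambientIsotopic_upToTwist`; (4) in the model,
the handle twists are fibre rotations whose product differs from `τ^{-m}` by a unit multiplier of
winding zero about every hole, which extends over the holes, and `D_k` is compressed into the
matched region by a model diffeomorphism supported in `U`, transported to `X` through `i`.

The two published theorems (2), (3) are filed as named facts by the sibling file
`…DcrGapHelperHandlebodyChartNamedFacts.lean` (relocated by the gate to
`Literature/Topology/FourManifolds/OneHandleUniqueness.lean`); this file PROVES step (1):

* `helper_handlebodyChart_ellipsoidStretch` — for a closed solid ellipsoid
  `S = {‖A(x - c)‖ ≤ 1}` (`A` a linear automorphism of `ℝ⁴`) inside an open `V`, a smooth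
  injective immersion `ψ : ℝ⁴ → V` equal to the identity on `S` (`ψ = c + A⁻¹ ∘ ballStretch R ∘ A(· - c)`
  with the tree's `ballStretch`, `BallStretch.lean`);
* `helper_handlebodyChart_compEmbedding` — a germ chart `i` (smooth injective immersion on an open
  `U`) composed with a smooth injective immersion `ψ : ℝ⁴ → U` is a global smooth embedding
  `i ∘ ψ : ℝ⁴ ↪ X` (inverse function theorem, `isLocalDiffeomorphAt_of_mfderiv_injective`, and
  `isSmoothEmbedding_of_isLocalDiffeomorph`) — the pattern of the landed `k = 0` instance
  `helper_handlebodyChart_zero`.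

Both helpers are registered sub-goals of the stub (`helper_handlebodyChart_*`); no `sorry`.

References: H. Whitney, *Differentiable manifolds*, Ann. of Math. 37 (1936) §II Thm. 6
[Whitney1936]; J. Milnor, *Lectures on the h-cobordism theorem* (1965), Thm. 8.4 and Remark,
Thm. 5.8 [MilnorHCobordism1965]; M. W. Hirsch, *Differential Topology* (1976), Ch. 4 §5 Thm. 5.3,
Ch. 8 §1 Thm. 1.3 [HirschDT1976]; A. Kosinski, *Differential Manifolds* (1993), III §3, VI §§5–6
[Kosinski1993].
-/

-- the prescribed namespace `Summit.<P>.<Sub>.…` duplicates `SmoothPoincare4` (P = Sub)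
set_option linter.dupNamespace false

noncomputable section

open scoped Manifold ContDiff Topology
open Function Set Metric

namespace Summit.SmoothPoincare4.SmoothPoincare4.Theorems.DcrGap.MkFriends

/-! ## Step (1): the base chart -/

/-- **Registered helper `helper_handlebodyChart_compEmbedding`: a germ chart composed with a
self-immersion of `ℝ⁴` into its domain is a global chart.**  If `i : ℝ⁴ → X` is smooth, injective
and immersive on the open set `U` of the `4`-manifold `X`, and `ψ : ℝ⁴ → ℝ⁴` is smooth and
injective with injective derivative everywhere and takes values in `U`, then `i ∘ ψ : ℝ⁴ → X` is a
smooth embedding (`Manifold.IsSmoothEmbedding`): it is smooth, injective, with injective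
differential everywhere (chain rule), hence a local diffeomorphism by the inverse function theorem
(`isLocalDiffeomorphAt_of_mfderiv_injective`) and so a smooth embedding
(`isSmoothEmbedding_of_isLocalDiffeomorph`; Lee, *Introduction to Smooth Manifolds* (2013),
Thm. 4.5, Prop. 5.2). [folklore] -/
theorem helper_handlebodyChart_compEmbedding : ∀ (X : Type) [TopologicalSpace X] [T2Space X] [SecondCountableTopology X] [ChartedSpace (EuclideanSpace ℝ (Fin 4)) X] [IsManifold (𝓡 4) ((⊤ : ℕ∞) : WithTop ℕ∞) X] (U : Set (EuclideanSpace ℝ (Fin 4))) (i : EuclideanSpace ℝ (Fin 4) → X) (ψ : EuclideanSpace ℝ (Fin 4) → EuclideanSpace ℝ (Fin 4)), (IsOpen U ∧ ContMDiffOn (𝓡 4) (𝓡 4) ((⊤ : ℕ∞) : WithTop ℕ∞) i U ∧ Set.InjOn i U ∧ (∀ x ∈ U, Function.Injective (mfderiv (𝓡 4) (𝓡 4) i x))) → ContDiff ℝ ((⊤ : ℕ∞) : WithTop ℕ∞) ψ → Function.Injective ψ → (∀ x, Function.Injective (fderiv ℝ ψ x)) → (∀ x, ψ x ∈ U) → Manifold.IsSmoothEmbedding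 (𝓡 4) (𝓡 4) ((⊤ : ℕ∞) : WithTop ℕ∞) (i ∘ ψ) := by
  intro X _ _ _ _ _ U i ψ h hψs hψinj hψd hψU
  obtain ⟨hU, hi, hinj, hd⟩ := h
  have hψm : ContMDiff (𝓡 4) (𝓡 4) ∞ ψ := hψs.contMDiff
  have hem : ContMDiff (𝓡 4) (𝓡 4) ∞ (i ∘ ψ) := hi.comp_contMDiff hψm hψU
  have heinj : Injective (i ∘ ψ) := fun x y hxy => hψinj (hinj (hψU x) (hψU y) hxy)
  have hn : (∞ : WithTop ℕ∞) ≠ 0 := by simp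
  have hed : ∀ x, Injective (mfderiv (𝓡 4) (𝓡 4) (i ∘ ψ) x) := fun x => by
    have h1 : MDifferentiableAt (𝓡 4) (𝓡 4) i (ψ x) :=
      (hi.contMDiffAt (hU.mem_nhds (hψU x))).mdifferentiableAt hn
    have h2 : MDifferentiableAt (𝓡 4) (𝓡 4) ψ x := (hψm x).mdifferentiableAt hn
    rw [mfderiv_comp x h1 h2]
    have h3 : mfderiv (𝓡 4) (𝓡 4) ψ x = fderiv ℝ ψ x := mfderiv_eq_fderiv
    rw [h3]
    exact (hd _ (hψU x)).comp (hψd x)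
  have hloc : IsLocalDiffeomorph (𝓡 4) (𝓡 4) ∞ (i ∘ ψ) := fun x =>
    Literature.Topology.FourManifolds.isLocalDiffeomorphAt_of_mfderiv_injective isOpen_univ (mem_univ x) hem.contMDiffOn
      (by exact_mod_cast le_top) rfl (hed x)
  exact Literature.Topology.FourManifolds.isSmoothEmbedding_of_isLocalDiffeomorph hloc heinj (ContinuousLinearEquiv.refl ℝ _)

/-- **Registered helper `helper_handlebodyChart_ellipsoidStretch`: a self-immersion of `ℝ⁴` into a
neighbourhood of a solid ellipsoid, fixing the ellipsoid.**  Let `A` be a linear automorphism of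
`ℝ⁴`, `c ∈ ℝ⁴`, and `V` an open set containing the closed solid ellipsoid
`S = {x : ‖A (x - c)‖ ≤ 1}`.  Then there is a smooth injective `ψ : ℝ⁴ → ℝ⁴` with injective
derivative everywhere, with values in `V`, and equal to the identity on `S`: in the coordinate
`y = A (x - c)` the set `V` contains a ball `B(0, R)`, `R > 1` (compactness of the closed unit
ball, `IsCompact.exists_thickening_subset_open`), and `ψ = c + A⁻¹ ∘ ballStretch R ∘ A (· - c)`
with the tree's ball stretch (`BallStretch.lean`: a diffeomorphism of `ℝ⁴` onto `B(0, R)` fixing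
the closed unit ball).  With `helper_handlebodyChart_compEmbedding` this is step (1) of the stub:
a germ chart `i` of `D_k` extends from any solid ellipsoid `S ⊂ U` to the global chart `i ∘ ψ`.
[cite: HirschDT1976, Ch. 8 §1] -/
theorem helper_handlebodyChart_ellipsoidStretch : ∀ (A : EuclideanSpace ℝ (Fin 4) ≃L[ℝ] EuclideanSpace ℝ (Fin 4)) (c : EuclideanSpace ℝ (Fin 4)) (V : Set (EuclideanSpace ℝ (Fin 4))), IsOpen V → {x : EuclideanSpace ℝ (Fin 4) | ‖A (x - c)‖ ≤ 1} ⊆ V → ∃ ψ : EuclideanSpace ℝ (Fin 4) → EuclideanSpace ℝ (Fin 4), ContDiff ℝ ((⊤ : ℕ∞) : WithTop ℕ∞) ψ ∧ Function.Injective ψ ∧ (∀ x, Function.Injective (fderiv ℝ ψ x)) ∧ (∀ x, ψ x ∈ V) ∧ (∀ x, ‖A (x - c)‖ ≤ 1 → ψ x = x) := by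
  intro A c V hV hSV
  -- the affine chart `α y = c + A⁻¹ y`; its inverse is `x ↦ A (x - c)`
  have hαc : Continuous fun y : EuclideanSpace ℝ (Fin 4) => c + A.symm y :=
    continuous_const.add A.symm.continuous
  -- Step 1: a radius `R = δ + 1 > 1` with `α (B(0, R)) ⊆ V`
  have hV' : IsOpen ((fun y : EuclideanSpace ℝ (Fin 4) => c + A.symm y) ⁻¹' V) := hV.preimage hαc
  have hsub : closedBall (0 : EuclideanSpace ℝ (Fin 4)) 1 ⊆
      (fun y : EuclideanSpace ℝ (Fin 4) => c + A.symm y) ⁻¹' V := fun y hy => by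
    refine hSV ?_
    show ‖A (c + A.symm y - c)‖ ≤ 1
    have : A (c + A.symm y - c) = y := by simp
    rw [this]
    exact mem_closedBall_zero_iff.1 hy
  obtain ⟨δ, hδ, hthick⟩ :=
    (isCompact_closedBall (0 : EuclideanSpace ℝ (Fin 4)) 1).exists_thickening_subset_open hV' hsub
  rw [thickening_closedBall hδ zero_le_one] at hthick
  have hR1 : 1 < δ + 1 := by linarith
  have hRV : ∀ y : EuclideanSpace ℝ (Fin 4), ‖y‖ < δ + 1 → c + A.symm y ∈ V :=
    fun y hy => hthick (mem_ball_zero_iff.2 hy)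
  -- Step 2: `ψ = α ∘ ballStretch R ∘ A (· - c)`
  have hd : ∀ x, HasFDerivAt
      (fun x : EuclideanSpace ℝ (Fin 4) => c + A.symm (Literature.Topology.FourManifolds.ballStretch (δ + 1) (A (x - c))))
      ((A.symm : EuclideanSpace ℝ (Fin 4) →L[ℝ] EuclideanSpace ℝ (Fin 4)).comp
        ((fderiv ℝ (Literature.Topology.FourManifolds.ballStretch (δ + 1)) (A (x - c))).comp
          (A : EuclideanSpace ℝ (Fin 4) →L[ℝ] EuclideanSpace ℝ (Fin 4)))) x := fun x => by
    have h1 : HasFDerivAt (fun x : EuclideanSpace ℝ (Fin 4) => A (x - c))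
        (A : EuclideanSpace ℝ (Fin 4) →L[ℝ] EuclideanSpace ℝ (Fin 4)) x := by
      have h := ((A : EuclideanSpace ℝ (Fin 4) →L[ℝ] EuclideanSpace ℝ (Fin 4)).hasFDerivAt
        (x := x - c)).comp x ((hasFDerivAt_id x).sub_const c)
      rw [ContinuousLinearMap.comp_id] at h
      exact h
    have h2 : HasFDerivAt (Literature.Topology.FourManifolds.ballStretch (δ + 1))
        (fderiv ℝ (Literature.Topology.FourManifolds.ballStretch (δ + 1)) (A (x - c))) (A (x - c)) :=
      (((Literature.Topology.FourManifolds.contDiff_ballStretch hR1).differentiable (by simp)) (A (x - c))).hasFDerivAt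
    have h3 := ((A.symm : EuclideanSpace ℝ (Fin 4) →L[ℝ] EuclideanSpace ℝ (Fin 4)).hasFDerivAt).comp x
      (h2.comp x h1)
    exact h3.const_add c
  refine ⟨fun x => c + A.symm (Literature.Topology.FourManifolds.ballStretch (δ + 1) (A (x - c))), ?_, ?_, fun x => ?_,
    fun x => hRV _ (Literature.Topology.FourManifolds.norm_ballStretch_lt hR1 _), fun x hx => ?_⟩
  · have hβs : ContDiff ℝ ∞ fun x : EuclideanSpace ℝ (Fin 4) => A (x - c) :=
      (A : EuclideanSpace ℝ (Fin 4) →L[ℝ] EuclideanSpace ℝ (Fin 4)).contDiff.comp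
        (contDiff_id.sub contDiff_const)
    exact contDiff_const.add
      ((A.symm : EuclideanSpace ℝ (Fin 4) →L[ℝ] EuclideanSpace ℝ (Fin 4)).contDiff.comp
        ((Literature.Topology.FourManifolds.contDiff_ballStretch hR1).comp hβs))
  · intro x x' h
    have h' : Literature.Topology.FourManifolds.ballStretch (δ + 1) (A (x - c)) =
        Literature.Topology.FourManifolds.ballStretch (δ + 1) (A (x' - c)) :=
      A.symm.injective (add_left_cancel h)
    have h'' : A (x - c) = A (x' - c) := Literature.Topology.FourManifolds.injective_ballStretch hR1 h'
    exact sub_left_injective (A.injective h'')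
  · rw [(hd x).fderiv]
    exact A.symm.injective.comp ((Literature.Topology.FourManifolds.injective_fderiv_ballStretch hR1 _).comp A.injective)
  · show c + A.symm (Literature.Topology.FourManifolds.ballStretch (δ + 1) (A (x - c))) = x
    rw [Literature.Topology.FourManifolds.ballStretch_eq_self hR1 hx]
    simp

end Summit.SmoothPoincare4.SmoothPoincare4.Theorems.DcrGap.MkFriends

end
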